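import Summits.QuantumFields.YangMills.Theorems.BalabanUVNodesN26AtRecord13FamilyTowerFlat

/-!
# DAG node N26 ∕ row (D4) — CRUX K2‴'s REGISTERED STUB `stub_d4AtSlopeCont13 : D4AtSlopeOfD1Record13` (stmt-QuantumFields-19911, plan g66's
# `K2Skeleton13.lean`) READ AT `(F, θ)` FROM A STAGE-12 [B13] FAMILY OF RECORD WITH NODE D SUPPLIED — p492935's clause (ii) repackaged in the
# stub's own letters (`∃ γ₁, 0 < γ₁ ∧ γ₁ ≤ θ.γ ∧ AtSlopeCont (split₁₃ θ) γ₁ (stepBal Nc Lc)`); the Record-13 twin of p478901's clause (iv)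

Cell pub-balaban, β-function sub-cell, BINDER row (D4) OWNER lineage `b2b-balaban-beta-an4` (gen 126; memo
`HOME/b2b-balaban-beta-an4/FLAT-LETTERS-LOCATED.md` §37).  Context: plan g66 SKELETONS-13 (pub-ymgap bus l.15942): the BC3 skeleton of crux K2‴
`EndpointGivenBR13` registers `stub_d1Residue13 : D1AtRecord13` (row (D1)) and **`stub_d4AtSlopeCont13 : D4AtSlopeOfD1Record13`** (rows (D4) ∧ B4
at (D1)'s slope) := `∀ F (θ : Stage13Params F 2) (hP : θ.Provisos₁₃ F 2), θ.Admissible F 2 → ∀ Lc [NeZero Lc] Js Nc, (β⁰ of the ₁₃ merged β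
pinned on `secondMoment (TbalOf Lc Js j) 0 1`) → D1Residue.Residue Lc Js Nc 0 1 → ∃ γ₀, 0 < γ₀ ∧ γ₀ ≤ θ.γ ∧ AtSlopeCont (oneLoopSplit_betaOfMerged
βm₁₃ (beta0OfMerged βm₁₃ θ.v₀) θ.γ) γ₀ (stepBal Nc Lc)` with `βm₁₃ := betaMerged F (mergedTermFamilyMatT F 2 (TcanOfRecord F 2) (chiFixed29 F 2 θ.ν
θ.ε₂₉) θ.εbg) θ.ρ8 θ.bV` — THIS ROW's deliverable at Record 13; dag-lead KEY TABLE WORDS-133; dag-ref-D READ-148∕157 (the N1 row at the witness of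
record is false; K2‴'s `∀ θ` vs the printed (D4) rows = a statement-of-record note for plan ∕ chair).

WHY THIS FILE.  p492935 (`…N26AtRecord13FamilyTowerFlat`, same gen) gives, from the Stage-12 [B13] family list at a Stage-13 tuple with NODE D
supplied by NE9's flat tower operator on the members' tori, clause (ii): `AtSlopeCont (split₁₃ θ) γ₀ s` for every slope `s` with `ε₁·K_rem,L∕2 ≤ s`,
from `Valid` and (C-leaf).  The registered stub asks, per `(F, θ, Lc, Js, Nc)`, for `∃ γ₁ ∈ ]0, θ.γ]` with `AtSlopeCont (split₁₃ θ) γ₁ (stepBal Nc Lc)`.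
This module writes that repackaging ONCE, in the stub's letters (at general `N`; the stub is `N := 2`): §1
`d4AtSlopeOfD1Record13_at_of_family_towerFlat` — the stub's consequent at `(F, θ, Lc, Nc)` from the family list + `0 < γ₀ ≤ θ.γ` + `Valid` + the
one-loop slope `ε₁·K_rem,L∕2 ≤ stepBal Nc Lc` + (C-leaf), witness `γ₁ := γ₀`.  It is for K2‴ what p478901's clause (iv) (over p478229's
`d4AtSlopeOfD1Record12_at_of_family`) was for the aside K2′: the stub AT θ with NODE D and N2 OFF the displayed list.

HONEST FRAMING.  Composition BY NAME (0 `def`, 0 `sorry`; one application of p492935); a REDUCTION of the stub at θ, NOT a proof of it: the stub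
quantifies over EVERY admissible θ with provisos — including K0a's witness of record `theta13LiveOfRecord` where the displayed N1 row `hC` at the FAITHFUL letters is FALSE
(its ε₂₉ = ⅛ violates the small row; n26-c p492818 `not_condsL_faithful_theta13LiveOfRecord`) —
and every remaining input is displayed: the (1.22) identification at the ₁₃ merged β (NODE O), the Stage-12 family with N10's family leaf + member
letters law and the run sequences with `n ↗` ∕ laws ∕ `Restr` (NODE O ∕ 00 ∕ A), the (4.4) seams from the tower's fine bond fields with holomorphic
activities (NODE B), the (1.7)∕(1.21) data with `hconv` on the flat vectors and the read-out (NODE E), (C-leaf), N1 ∕ N3 at the letters of record, the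
one-loop slope.  NODE D on the MODEL class.  (D4) INSTANCE 0∕1, D4 DISCHARGE NO DATE; K2‴ NOT proved; N25 ∕ N26 NOT discharged; counts unmoved.
One finite four-torus programme at fixed ε per run — NOT the continuum limit, NOT ℝ⁴, NOT infinite volume, NOT OS, NOT a mass gap, NOT Clay.  No
`instance`, no `notation`, no `axiom`.
Sources (context): [I] = [Balaban1987RG1] CMP **109** (1987): Thm 2 p. 259, (1.7) p. 261, (1.20)–(1.22) p. 264, (2.9) p. 266, (4.4) p. 281, (4.35)
p. 290, (5.1) p. 292; [II] = [Balaban1988RG2Cluster] CMP **116** (1988): Lemma 3 (2.38) p. 20, p. 21; [15] = [Balaban1985Variational] CMP **102**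
(1985): (190) p. 308.
-/

noncomputable section

open scoped Matrix.Norms.L2Operator InnerProductSpace ComplexConjugate

namespace Summit.QuantumFields.YangMills.Theorems.BalabanUVNodesN26AtRecord13StubD4TowerFlat

open Literature.MathematicalPhysics.QuantumFieldTheory.Balaban1983to89
open Literature.MathematicalPhysics.QuantumFieldTheory.Balaban1983to89.FlowStep
open Literature.MathematicalPhysics.QuantumFieldTheory.Balaban1983to89.T4Continuum (T4Family)
open Literature.MathematicalPhysics.QuantumFieldTheory.Balaban1983to89.Node00
open Literature.MathematicalPhysics.QuantumFieldTheory.Balaban1983to89.B13ScaleTransfer (Pt)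
open Literature.MathematicalPhysics.QuantumFieldTheory.Balaban1983to89.TreeLengthTorus (TPt TDom proj)
open Literature.MathematicalPhysics.QuantumFieldTheory.Balaban1983to89.B4Sect5Torus (TSite)
open Literature.MathematicalPhysics.QuantumFieldTheory.Balaban1983to89.B12Decay510 (mixedDeriv)
open Literature.MathematicalPhysics.QuantumFieldTheory.Balaban1983to89.B12Decay510Torus (tcubeOf)
open Literature.MathematicalPhysics.QuantumFieldTheory.Balaban1983to89.B9SectCLatticeCarrier (Bond bpos)
open Literature.MathematicalPhysics.QuantumFieldTheory.Balaban1983to89.B9Eq311L2Pairing (WL2)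
open Literature.MathematicalPhysics.QuantumFieldTheory.Balaban1983to89.B9Eq315QTower (towerP UlevOf)
open Literature.MathematicalPhysics.QuantumFieldTheory.Balaban1983to89.B9Eq315QTorus (perCfg cornerSite)
open Literature.MathematicalPhysics.QuantumFieldTheory.Balaban1983to89.B9Eq319QprimeTorus (blockCoord)
open Literature.MathematicalPhysics.QuantumFieldTheory.Balaban1983to89.B9Eq316TowerFlatIsOneStep (siteCast towerP_eq_fineP_pow)
open Literature.MathematicalPhysics.QuantumFieldTheory.Balaban1983to89.B7Prop1Explicit (U1 Wcx boxVec)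
open Literature.MathematicalPhysics.QuantumFieldTheory.Balaban1983to89.B7Prop2Explicit (c2')
open Literature.MathematicalPhysics.QuantumFieldTheory.Balaban1983to89.B11Eq103H1Complex (BondL2K)
open Literature.MathematicalPhysics.QuantumFieldTheory.Balaban1983to89.B9Eq326OperatorTower (laplaceAk H1k)
open Literature.MathematicalPhysics.QuantumFieldTheory.Balaban1983to89.Beta.RemainderChainLattice
open Literature.MathematicalPhysics.QuantumFieldTheory.Balaban1983to89.Beta.RemainderLimitTorus (LDom limKernel tproj)
open Literature.MathematicalPhysics.QuantumFieldTheory.Balaban1983to89.Beta.RemainderDecay190 (Consts190 Data190)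
open Literature.MathematicalPhysics.QuantumFieldTheory.Balaban1983to89.Beta.RemainderDecay190HoloChain (ChainTFac190H)
open Literature.MathematicalPhysics.QuantumFieldTheory.Balaban1983to89.Beta.RemainderWOfRecordB13 (SpLaw Law213 NOfLayers)
open Literature.MathematicalPhysics.QuantumFieldTheory.Balaban1983to89.Beta.RemainderData190TowerFlat (exists_data190_tower_flat)
open Summit.QuantumFields.BalabanUV.Gaps
open Summit.QuantumFields.BalabanUV.Gaps.BetaContFromD4Chain
open Summit.QuantumFields.YangMills.Theorems.BalabanUVNodesN26AtRecord13FamilyTowerFlat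
  (exists_chainTFac190H_betaOfRecord₁₃_of_family_towerFlat)
open Metric Filter Topology

variable (F : T4Family) (N : ℕ) [NeZero N]

/-! ## §1 The registered K2‴ stub `D4AtSlopeOfD1Record13`'s consequent AT (F, θ, Lc, Nc) from the family list with NODE D supplied (p492935 clause (ii), repackaged in the stub's letters) -/

section StubD4TowerFlat

-- NE9's tower structure data ([5] §3 ∕ [15]: block size `L ≥ 3`, the C⋆-algebra `𝔸`, its Hilbert model `W ≃ 𝔸`, the trace `τ`, `a, a′, ρ_w, A_Q`)
variable (L : ℕ) [NeZero L] (hL : 1 ≤ L) (hL3 : 3 ≤ L)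
  {𝔸 : Type*} [CStarAlgebra 𝔸] [Nontrivial 𝔸]
  {W : Type} [NormedAddCommGroup W] [InnerProductSpace ℂ W] [FiniteDimensional ℂ W] (φ : W ≃ₗ[ℂ] 𝔸)
  {Mφ Mφ' : ℝ} (hMφ : 0 ≤ Mφ) (hMφ' : 0 ≤ Mφ') (hφ : ∀ w, ‖φ w‖ ≤ Mφ * ‖w‖) (hφ' : ∀ X, ‖φ.symm X‖ ≤ Mφ' * ‖X‖)
  {a₁ : ℝ} (ha₁ : 0 < a₁) {a₁' : ℝ} (ha₁' : 0 < a₁')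
  (τ : 𝔸 →ₗ[ℂ] ℂ) {Cτ : ℝ} (hτ : ∀ X, ‖τ X‖ ≤ Cτ * ‖X‖) (hCτ : 0 ≤ Cτ) {Mτ : ℝ}
  (hτm : ∀ X Y : 𝔸, ‖τ (X * Y)‖ ≤ Mτ * ‖X‖ * ‖Y‖) (hMτ : 0 ≤ Mτ) {ρw : ℝ} (hρw : 0 ≤ ρw)
  (hτ₁ : ∀ X : 𝔸, τ (star X) = conj (τ X)) (hτ₂ : ∀ X Y : 𝔸, τ (X * Y) = τ (Y * X))
  (hφτ : ∀ X Y : 𝔸, ⟪φ.symm X, φ.symm Y⟫_ℂ = τ (star X * Y))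
  (AQ : ℝ) (hAQ16 : 16 * (((4 : ℕ) : ℝ) + 1) * (((4 : ℕ) : ℝ) + 4) * c2' 4 L ≤ AQ)

include hL3 hMφ hMφ' hφ hφ' ha₁ ha₁' hτ hCτ hτm hMτ hρw hτ₁ hτ₂ hφτ hAQ16

/-- **CRUX K2‴'s REGISTERED STUB `stub_d4AtSlopeCont13 : D4AtSlopeOfD1Record13` (plan g66 `K2Skeleton13.lean` 3f282f2ad62aefca, stmt-QuantumFields-19911) — ITS CONSEQUENT
AT `(F, θ, Lc, Nc)` IN THE STUB's OWN LETTERS, FROM A STAGE-12 [B13] FAMILY OF RECORD WITH NODE D SUPPLIED BY NE9's FLAT TOWER OPERATOR**: the family list of p492935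
(`exists_chainTFac190H_betaOfRecord₁₃_of_family_towerFlat`: `θ : Stage13Params F N`, residual letters `cR`, `lamF : ResidB13Fam₁₂ F N θ.toStage12Params`, box `γ₀ ≤ θ.γ`, leaf
kernels `A1` with the (1.22) identification at the ₁₃ merged β, member letters law + N10's family leaf, run sequences with growing tori ∕ laws ∕ `Restr`, N1 ∕ N3 at the letters of
record, NE9 structure data + weights + geometry letters + numerics on `q`, ANY display ∕ witness per (k, v, m), seams and (1.7) data ON THE TOWER's FINE BOND FIELDS with `hconv` READ ON
THE EXPLICIT FLAT (4.35) VECTORS, read-out `ha`) PLUS `0 < γ₀`, `Valid`, the one-loop slope `ε₁·K_rem,L∕2 ≤ stepBal Nc Lc` and (C-leaf) in the read-out letters ⟹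
`∃ γ₁, 0 < γ₁ ∧ γ₁ ≤ θ.γ ∧ AtSlopeCont (oneLoopSplit_betaOfMerged βm₁₃ (beta0OfMerged βm₁₃ θ.v₀) θ.γ) γ₁ (stepBal Nc Lc)` with
`βm₁₃ := betaMerged F (mergedTermFamilyMatT F N (TcanOfRecord F N) (chiFixed29 F N θ.ν θ.ε₂₉) θ.εbg) θ.ρ8 θ.bV` — at `N := 2` LITERALLY the consequent of `D4AtSlopeOfD1Record13` at
`(F, θ, hP, hAdm, Lc, Js, Nc)` (its antecedents `hP`, `Admissible`, the (D1) pin `hβ0` and `D1Residue.Residue` are not used by the (D4) side).  A REDUCTION of the stub AT θ to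
displayed inputs with NODE D OFF the list (the ₁₃ twin of p478901 clause (iv) ∕ p478229's `d4AtSlopeOfD1Record12_at_of_family` for the aside K2′) — NOT a proof of the stub:
`∀ θ` ranges over every admissible θ with provisos, and at the witness of record `theta13LiveOfRecord` the displayed N1 row `hC` at the faithful letters is FALSE (ε₂₉ = ⅛;
dag-ref-D READ-148∕157, n26-c p492818 `not_condsL_faithful_theta13LiveOfRecord`) — instantiable at K0a FILE 9's open-letter members with `hsmall`.  The residual letters
`cR` are general; K2‴'s helpers read the FAITHFUL ones `cR := { c₀ with ε₁ := θ.ε₂₉ }` (dag-ref-D READ-156 (a); n26-c p491248 §3 `c13OfRecord₁₂_faithful_eq`), an instance by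
substitution.  Instance 0∕1; K2‴ NOT proved.
[cite: Balaban1988RG2Cluster, Lemma 3 (2.38) p.20 and p.21; Balaban1987RG1, Thm 2 p.259, (1.7) p.261, (1.20)-(1.22) p.264, (2.9) p.266, (4.4) p.281, (4.35) p.290, (5.1) p.292; Balaban1985Variational, (190) p.308] -/
theorem d4AtSlopeOfD1Record13_at_of_family_towerFlat :
    ∃ δs Cs : ℝ, 0 < δs ∧ 0 ≤ Cs ∧
      ∀ -- tower weights per scale `k` (height `k + 1`)
        (η : ℕ → ℝ) (_hηL : ∀ k, η k * (L : ℝ) ^ (k + 1) = 1) (c₀ c₁ : ℕ → ℝ) [∀ k, Fact (0 < c₀ k)] [∀ k, Fact (0 < c₁ k)]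
        (_hw : ∀ k, c₀ k * ((L : ℝ) ^ (k + 1)) ^ 4 = c₁ k) (_hρ : ∀ k, |η k| ^ 4 / c₀ k ≤ ρw)
        -- cube side, size indices, block-geometry letters, source direction ∕ value, the (190)-record under numerics only
        (M : ℕ) [NeZero M] (I : Type) (_i₀ : I) (η₀ L₀ M₀ Rg : ℕ → ℝ) (Hg : ℕ → Prop) (μ₀ : Fin 4) (w₀ : W)
        (q : Consts190) (δr : ℝ) (_hδr : 0 < δr) (_hσ₀ : 0 < q.σ) (_hcR : B6.c0 δr (q.σ / δr) ^ 4 ≤ q.cR) (_hκB : 1 ≤ q.κB)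
        (_hδ15 : q.δ15 ≤ δs) (_hCst : Cs ≤ q.Cst) (_hmw : ‖w₀‖ ≤ q.m) (_hθ1 : q.θ ≤ 1)
        -- the Stage-13 tuple, the residual letters, a Stage-12 [B13] FAMILY of record, the box, the leaf kernels with the (1.22) identification AT THE STAGE-13 MERGED β
        (γ₀ : ℝ) (μ ν : Fin 4) (α₂ : ℝ) (θ : Stage13Params F N) (cR : B13.Consts) (lamF : ResidB13Fam₁₂ F N θ.toStage12Params)
        (_hle : γ₀ ≤ θ.γ) (A1 : (k : ℕ) → (Fin (k + 1) → ℝ) → LDom 4 → Pt 4 → ℝ)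
        (_hm : letI := θ.instVβ₁; letI := θ.instVβ₂; letI := θ.instιβ
          ∀ k (v : Fin (k + 1) → ℝ), v ∈ Box γ₀ k →
            betaMerged F (mergedTermFamilyMatT F N (TcanOfRecord F N) (chiFixed29 F N θ.ν θ.ε₂₉) θ.εbg) θ.ρ8 θ.bV k v =
              beta0OfMerged (betaMerged F (mergedTermFamilyMatT F N (TcanOfRecord F N) (chiFixed29 F N θ.ν θ.ε₂₉) θ.εbg) θ.ρ8 θ.bV) θ.v₀ k +
                B12Beta.secondMoment (fun _ _ => limKernel (A1 k v)) μ ν)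
        -- N10's in-edge in the FAMILY currency at every run and the member letters law on the box, at the Stage-12 part (letters of record `c13OfRecord₁₂ θ.toStage12Params cR`)
        (_hcF : ∀ P k v, v ∈ Box γ₀ k → (lamF P k v).c = c13OfRecord₁₂ F N θ.toStage12Params cR)
        (_hleafF : ∀ P, B13FamLeafOfRecord₁₂ F N θ.toStage12Params cR lamF P)
        -- per (scale, history) IN THE BOX: a RUN SEQUENCE whose members AT THAT HISTORY have growing coarse tori, their laws and restriction sentences
        (Ps : (k : ℕ) → (Fin (k + 1) → ℝ) → ℕ → B12.RunParams)
        (_hn : ∀ k v, v ∈ Box γ₀ k → Tendsto (fun m => (lamF (Ps k v m) k v).n) atTop atTop)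
        (_hsp : ∀ k v, v ∈ Box γ₀ k → ∀ m, SpLaw (lamF (Ps k v m) k v))
        (_h213 : ∀ k v, v ∈ Box γ₀ k → ∀ m, Law213 (lamF (Ps k v m) k v))
        (_hR : ∀ k v, v ∈ Box γ₀ k → ∀ m, (lamF (Ps k v m) k v).Restr)
        -- N1 ∕ N3 at the LETTERS OF RECORD and ℓ = ½L
        (_hC : CondsL 4 (c13OfRecord₁₂ F N θ.toStage12Params cR) (((c13OfRecord₁₂ F N θ.toStage12Params cR).L : ℝ) / 2)) (_hs : SignsL (c13OfRecord₁₂ F N θ.toStage12Params cR) α₂ q.B₃)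
        -- ANY admissible regularity display and positivity witness of `Δ_{a,k}(1)` per (k, v, m) on the tower over the member's torus
        (αU : (k : ℕ) → (Fin (k + 1) → ℝ) → ℕ → ℕ → ℝ) (hα1 : ∀ k v m j, αU k v m j ≤ 1 / 64)
        (hαL : ∀ k v m j, 50 * (((4 : ℕ) : ℝ) + 1) * αU k v m j * (L : ℝ) ^ 4 ≤ 1 / 2)
        (hU1 : ∀ k v m (j : ℕ) (z : B7Prop1Explicit.Site 4) (κ : Fin 4),
          perCfg (towerP L (fun _ : Fin 4 => NOfLayers (fun m => lamF (Ps k v m) k v) m * M) (j + 1))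
            (UlevOf L (fun _ : Fin 4 => NOfLayers (fun m => lamF (Ps k v m) k v) m * M) (k + 1) (fun _ => (1 : 𝔸ˣ)) j) z κ ∈ U1 𝔸)
        (hreg : ∀ k v m (j : ℕ) (y : TSite 4 (towerP L (fun _ : Fin 4 => NOfLayers (fun m => lamF (Ps k v m) k v) m * M) j)) (κ : Fin 4)
          (ρ' : Fin 4 → Fin L),
          ‖((Wcx L (perCfg (towerP L (fun _ : Fin 4 => NOfLayers (fun m => lamF (Ps k v m) k v) m * M) (j + 1))
              (UlevOf L (fun _ : Fin 4 => NOfLayers (fun m => lamF (Ps k v m) k v) m * M) (k + 1) (fun _ => (1 : 𝔸ˣ)) j))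
              (cornerSite L y) κ (boxVec L ρ') : 𝔸ˣ) : 𝔸) - 1‖ ≤ αU k v m j)
        (hpos : ∀ k v m (u : BondL2K ℂ 4 (towerP L (fun _ : Fin 4 => NOfLayers (fun m => lamF (Ps k v m) k v) m * M) (k + 1)) (c₀ k) W), u ≠ 0 →
          0 < RCLike.re ⟪u, laplaceAk L (fun _ : Fin 4 => NOfLayers (fun m => lamF (Ps k v m) k v) m * M) k φ (η k) (fun _ => (1 : 𝔸ˣ)) hL
            (αU k v m) (hα1 k v m) (hU1 k v m) (hreg k v m) τ (c₀ := c₀ k) (c₁ := c₁ k) a₁ u⟫_ℂ)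
        -- the (4.4) seams FROM THE TOWER's FINE BOND FIELDS into the members' spaces p. 15, the members' ACTIVITIES holomorphic along them (on the box)
        (emb : (k : ℕ) → (v : Fin (k + 1) → ℝ) → (m : ℕ) → TDom 4 ((lamF (Ps k v m) k v).n + 1) → (Bond 4 (towerP L (fun _ : Fin 4 => NOfLayers (fun m => lamF (Ps k v m) k v) m * M) (k + 1)) → W) → (lamF (Ps k v m) k v).Φ)
        (_hemb : ∀ k v, v ∈ Box γ₀ k → ∀ m X, ∀ u ∈ ball (0 : Bond 4 (towerP L (fun _ : Fin 4 => NOfLayers (fun m => lamF (Ps k v m) k v) m * M) (k + 1)) → W) α₂, emb k v m X u ∈ (lamF (Ps k v m) k v).sp2 X)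
        (_hH : ∀ k v, v ∈ Box γ₀ k → ∀ m (X Z : TDom 4 ((lamF (Ps k v m) k v).n + 1)), Z.1 ⊆ X.1 →
          DifferentiableOn ℂ (fun u => (lamF (Ps k v m) k v).H Z (emb k v m X u)) (ball 0 α₂))
        -- the (1.7) ∕ test-vector-limit data (on the box), the limit READ ON THE EXPLICIT FLAT TEST VECTORS, and the read-out of the leaf kernels
        (V : (k : ℕ) → (Fin (k + 1) → ℝ) → LDom 4 → Type) (_instV : ∀ k v Y, NormedAddCommGroup (V k v Y))
        (_instVs : ∀ k v Y, NormedSpace ℂ (V k v Y))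
        (Fw : (k : ℕ) → (v : Fin (k + 1) → ℝ) → (Y : LDom 4) → V k v Y → ℂ)
        (_hFd : ∀ k v, v ∈ Box γ₀ k → ∀ Y, ∃ ρ > 0, DifferentiableOn ℂ (Fw k v Y) (ball 0 ρ))
        (r : (k : ℕ) → (v : Fin (k + 1) → ℝ) → (m : ℕ) → (Y : LDom 4) → (Bond 4 (towerP L (fun _ : Fin 4 => NOfLayers (fun m => lamF (Ps k v m) k v) m * M) (k + 1)) → W) →L[ℂ] V k v Y)
        (_hfac : ∀ k v, v ∈ Box γ₀ k → ∀ Y : LDom 4, ∀ᶠ m in atTop, ∀ u ∈ ball (0 : Bond 4 (towerP L (fun _ : Fin 4 => NOfLayers (fun m => lamF (Ps k v m) k v) m * M) (k + 1)) → W) α₂,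
          (lamF (Ps k v m) k v).Ek1 (tproj ((lamF (Ps k v m) k v).n + 1) Y) (emb k v m (tproj ((lamF (Ps k v m) k v).n + 1) Y) u) = Fw k v Y (r k v m Y u))
        (t : (k : ℕ) → (v : Fin (k + 1) → ℝ) → (Y : LDom 4) → Pt 4 → V k v Y)
        (_hconv : ∀ k v, v ∈ Box γ₀ k → ∀ (Y : LDom 4) (x : Pt 4),
          Tendsto (fun m => r k v m Y
            (fun b : Bond 4 (towerP L (fun _ : Fin 4 => NOfLayers (fun m => lamF (Ps k v m) k v) m * M) (k + 1)) =>
              if tcubeOf (NOfLayers (fun m => lamF (Ps k v m) k v) m) M (fun i => ((blockCoord (L ^ (k + 1)) (fun _ : Fin 4 => NOfLayers (fun m => lamF (Ps k v m) k v) m * M)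
                    (siteCast (towerP_eq_fineP_pow L (fun _ : Fin 4 => NOfLayers (fun m => lamF (Ps k v m) k v) m * M) (k + 1)) (bpos b)) i : ℕ) :
                      ZMod (NOfLayers (fun m => lamF (Ps k v m) k v) m * M))) ∈ (tproj ((lamF (Ps k v m) k v).n + 1) Y).1 then
                ((WL2.linearEquiv ℂ ℂ (fun _ : Bond 4 (towerP L (fun _ : Fin 4 => NOfLayers (fun m => lamF (Ps k v m) k v) m * M) (k + 1)) => c₀ k) :
                    BondL2K ℂ 4 (towerP L (fun _ : Fin 4 => NOfLayers (fun m => lamF (Ps k v m) k v) m * M) (k + 1)) (c₀ k) W ≃ₗ[ℂ] (Bond 4 (towerP L (fun _ : Fin 4 => NOfLayers (fun m => lamF (Ps k v m) k v) m * M) (k + 1)) → W))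
                  (H1k L (fun _ : Fin 4 => NOfLayers (fun m => lamF (Ps k v m) k v) m * M) k φ (η k) (fun _ => (1 : 𝔸ˣ)) hL (αU k v m) (hα1 k v m)
                    (hU1 k v m) (hreg k v m) τ (c₀ := c₀ k) (c₁ := c₁ k) (hαL k v m) (hpos k v m)
                    ((WL2.linearEquiv ℂ ℂ (fun _ : Bond 4 (fun _ : Fin 4 => NOfLayers (fun m => lamF (Ps k v m) k v) m * M) => c₁ k) :
                        BondL2K ℂ 4 (fun _ : Fin 4 => NOfLayers (fun m => lamF (Ps k v m) k v) m * M) (c₁ k) W ≃ₗ[ℂ]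
                          (Bond 4 (fun _ : Fin 4 => NOfLayers (fun m => lamF (Ps k v m) k v) m * M) → W)).symm
                      (Pi.single ((fun i => (⟨((proj (((lamF (Ps k v m) k v).n + 1) * M) x) i).val,
                          ZMod.val_lt ((proj (((lamF (Ps k v m) k v).n + 1) * M) x) i)⟩ : Fin (NOfLayers (fun m => lamF (Ps k v m) k v) m * M))), μ₀) w₀)))) b
              else 0)) atTop (𝓝 (t k v Y x)))
        (_ha : ∀ k v, v ∈ Box γ₀ k → ∀ (Y : LDom 4) (z : Pt 4), A1 k v Y z = (mixedDeriv (Fw k v Y) (t k v Y 0) (t k v Y z)).re)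
        -- the box is a positive box, N3, the one-loop slope at (D1)'s step normalization, (C-leaf) in the (1.7) read-out letters
        (_hγ₀ : 0 < γ₀) (_hq : q.Valid (c13OfRecord₁₂ F N θ.toStage12Params cR).δ₀) (Lc : ℕ) (Nc : ℝ)
        (_hsmall : (c13OfRecord₁₂ F N θ.toStage12Params cR).ε₁ * remCoeffL 4 M (c13OfRecord₁₂ F N θ.toStage12Params cR) α₂ q.B₃ ≤
          B12Normalization.stepBal Nc Lc)
        (_hcont : ∀ k (Y : LDom 4) (z : Pt 4),
          ContinuousOn (fun v : Fin (k + 1) → ℝ => (mixedDeriv (Fw k v Y) (t k v Y 0) (t k v Y z)).re) (Box γ₀ k)),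
      letI := θ.instVβ₁; letI := θ.instVβ₂; letI := θ.instιβ
      ∃ γ₁ : ℝ, 0 < γ₁ ∧ γ₁ ≤ θ.γ ∧
        AtSlopeCont
          (oneLoopSplit_betaOfMerged
            (betaMerged F (mergedTermFamilyMatT F N (TcanOfRecord F N) (chiFixed29 F N θ.ν θ.ε₂₉) θ.εbg) θ.ρ8 θ.bV)
            (beta0OfMerged (betaMerged F (mergedTermFamilyMatT F N (TcanOfRecord F N) (chiFixed29 F N θ.ν θ.ε₂₉) θ.εbg) θ.ρ8 θ.bV)
              θ.v₀) θ.γ)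
          γ₁ (B12Normalization.stepBal Nc Lc) := by
  obtain ⟨δs, Cs, hδs, hCs, H⟩ :=
    exists_chainTFac190H_betaOfRecord₁₃_of_family_towerFlat F N L hL hL3 φ hMφ hMφ' hφ hφ' ha₁ ha₁' τ hτ hCτ hτm hMτ hρw hτ₁ hτ₂
      hφτ AQ hAQ16
  refine ⟨δs, Cs, hδs, hCs, ?_⟩
  intro η hηL c₀ c₁ _ _ hw hρ M _ I i₀ η₀ L₀ M₀ Rg Hg μ₀ w₀ q δr hδr hσ₀ hcR hκB hδ15 hCst hmw hθ1 γ₀ μ ν α₂ θ cR lamF hle A1 hm hcF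
    hleafF Ps hn hsp h213 hR hC hs αU hα1 hαL hU1 hreg hpos emb hemb hH V instV instVs Fw hFd r hfac t hconv ha hγ₀ hq Lc Nc hsmall hcont
  exact ⟨γ₀, hγ₀, hle,
    (H η hηL c₀ c₁ hw hρ M I i₀ η₀ L₀ M₀ Rg Hg μ₀ w₀ q δr hδr hσ₀ hcR hκB hδ15 hCst hmw hθ1 γ₀ μ ν α₂ θ cR lamF hle A1 hm hcF
      hleafF Ps hn hsp h213 hR hC hs αU hα1 hαL hU1 hreg hpos emb hemb hH V instV instVs Fw hFd r hfac t hconv ha).2.1 hq _ hsmall hcont⟩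

end StubD4TowerFlat

end Summit.QuantumFields.YangMills.Theorems.BalabanUVNodesN26AtRecord13StubD4TowerFlat

end
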